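import Summits.AnomalousDissipation.AnomalousDissipation.Theorems.SawtoothPulseCascadeK1LocalisedCascadeTwoToothOffLobeSharp
import Summits.AnomalousDissipation.AnomalousDissipation.Theorems.SawtoothPulseCascadeK1LocalisedCascadePhaseOneOffTube

/-!
# K1loc explicit start, phase 1: OFF-TUBE ENERGY OF `b₁`, SHARP PER-FIBRE BOUND AND BLOCK CONSTANTS («PhaseOneOffTubeSum»)

Helper file of the prover lane on the crux `K1LocalisedCascade` (stmt-AnomalousDissipation-19491), route `SawtoothPulseCascade`
(arbiter A24-6 (1): table campaign).  Ingredients of the far term `ε(D₀) := Σ'_k [D₀ ≤ ||k₁| − 8|k₀||] ‖𝓕b₁(k)‖²` of the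
tube Cauchy–Schwarz / profile-Minkowski bounds for `j_V`, `j_O` (the numeric assembly is `PhaseOneOffTubeBound`):
* §1 `offLobeMass_le_block`: the sharp off-lobe mass constant `M(q,E)` of `TwoToothOffLobeSharp` (N = 2, L = 4q) is bounded on a
  block `lo ≤ |q| ≤ hi` by an explicit rational multiple of `1/π²`;
* §2 small arithmetic helpers (`X/(π²D) ≤ 0.101322·X/D` from `inv_pi_sq_le`, block steps);
* §3 `phaseOne_offTube_fibre_sharp`: one H-fibre off the tube, `≤ (L̄_q(√M(q,E) + 2⁻²⁷|q|) + √R_q)²` (`2E + Q_c ≤ D₀`);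
No definitions; nothing about the crux. [cite: Grafakos2014, Prop. 3.1.2 (5), Prop. 3.2.7 (3)] [problem: turb]
-/

-- `Summit.<Summit>.<Problem>`: single-conjunct summit, the duplicate namespace segment is deliberate.
set_option linter.dupNamespace false

noncomputable section

namespace Summit.AnomalousDissipation.AnomalousDissipation.Theorems.SawtoothPulseCascade.K1Start

open MeasureTheory Filter Topology UnitAddTorus Complex AddCircle
open scoped Real
open Literature.Analysis Literature.Analysis.FunctionSpaces Literature.Analysis.FunctionSpaces.Torus Literature.Analysis.FluidPDE
open Literature.Analysis.FluidPDE.ShearStage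
open Literature.Analysis.FluidPDE.SawtoothCascade Literature.Analysis.FluidPDE.SawtoothCascade.CascadeParams
open Summit.AnomalousDissipation.AnomalousDissipation.Theorems.SawtoothPulseCascade.K1Window

/-! ## §1 The sharp off-lobe mass constant on a block of fibres -/

/-- **Block bound of the sharp mass constant** (`N = 2`, `L = 4q`): for `lo ≤ |q| ≤ hi` (and `lo₂ ≤ |q|` whenever the inside
term is present), `M(q,E) ≤ 2(4hi)²/(π²(E+4lo)(E−1)(E+8lo−1)) + [E ≤ 4hi]·(1/(π²(E−1)) + 2(4hi−E+1)/(π²·4lo₂·E))`. [folklore] -/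
theorem offLobeMass_le_block {E lo hi lo2 : ℕ} (hE : 2 ≤ E) (hlo2 : 0 < lo2) {q : ℤ} (hlo : (lo : ℤ) ≤ |q|) (hhi : |q| ≤ hi)
    (hq2 : (E : ℤ) ≤ 4 * |q| → (lo2 : ℤ) ≤ |q|) :
    2 * ((4 * q : ℤ) : ℝ) ^ 2 / (π ^ 2 * (((E : ℝ) + |((4 * q : ℤ) : ℝ)|) * (((E : ℝ) - 1) * ((E : ℝ) + 2 * |((4 * q : ℤ) : ℝ)| - 1)))) +
        (if (E : ℤ) ≤ |(4 * q : ℤ)| then 1 / (π ^ 2 * ((E : ℝ) - 1)) + 2 * (|((4 * q : ℤ) : ℝ)| - E + 1) / (π ^ 2 * (|((4 * q : ℤ) : ℝ)| * E)) else 0) ≤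
      2 * (4 * (hi : ℝ)) ^ 2 / (π ^ 2 * (((E : ℝ) + 4 * lo) * (((E : ℝ) - 1) * ((E : ℝ) + 8 * lo - 1)))) +
        (if (E : ℤ) ≤ 4 * hi then 1 / (π ^ 2 * ((E : ℝ) - 1)) + 2 * (4 * (hi : ℝ) - E + 1) / (π ^ 2 * (4 * (lo2 : ℝ) * E)) else 0) := by
  have hπ : 0 < π := Real.pi_pos
  have hE' : (2 : ℝ) ≤ E := by exact_mod_cast hE
  have hq4 : |((4 * q : ℤ) : ℝ)| = 4 * |(q : ℝ)| := by push_cast; rw [abs_mul, abs_of_pos (by norm_num : (0:ℝ) < 4)]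
  have hlor : (lo : ℝ) ≤ |(q : ℝ)| := by
    have h : ((lo : ℤ) : ℝ) ≤ ((|q| : ℤ) : ℝ) := by exact_mod_cast hlo
    push_cast at h; exact h
  have hhir : |(q : ℝ)| ≤ hi := by
    have h : ((|q| : ℤ) : ℝ) ≤ ((hi : ℤ) : ℝ) := by exact_mod_cast hhi
    push_cast at h; exact h
  have hlo0 : (0 : ℝ) ≤ lo := Nat.cast_nonneg _
  refine add_le_add ?_ ?_
  · -- outside part: numerator up, denominators down
    rw [hq4, show ((4 * q : ℤ) : ℝ) ^ 2 = (4 * |(q : ℝ)|) ^ 2 by push_cast; rw [mul_pow, mul_pow, sq_abs]]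
    have hnum : (4 * |(q : ℝ)|) ^ 2 ≤ (4 * (hi : ℝ)) ^ 2 := pow_le_pow_left₀ (by positivity) (by linarith) 2
    have hd1 : ((E : ℝ)) + 4 * lo ≤ (E : ℝ) + 4 * |(q : ℝ)| := by linarith
    have hd2 : ((E : ℝ)) + 8 * lo - 1 ≤ (E : ℝ) + 2 * (4 * |(q : ℝ)|) - 1 := by linarith
    have hD0 : 0 < π ^ 2 * (((E : ℝ) + 4 * lo) * (((E : ℝ) - 1) * ((E : ℝ) + 8 * lo - 1))) := by
      have : 0 < (E : ℝ) - 1 := by linarith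
      have : 0 < (E : ℝ) + 8 * lo - 1 := by linarith
      positivity
    have hpos1 : 0 < (E : ℝ) + 4 * |(q : ℝ)| := by linarith
    have hpos2 : 0 < (E : ℝ) + 2 * (4 * |(q : ℝ)|) - 1 := by linarith
    have h1 : 0 ≤ (E : ℝ) - 1 := by linarith
    have hE1 : 0 < (E : ℝ) - 1 := by linarith
    have hD1 : 0 < π ^ 2 * (((E : ℝ) + 4 * |(q : ℝ)|) * (((E : ℝ) - 1) * ((E : ℝ) + 2 * (4 * |(q : ℝ)|) - 1))) :=
      mul_pos (pow_pos hπ 2) (mul_pos hpos1 (mul_pos hE1 hpos2))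
    calc 2 * (4 * |(q : ℝ)|) ^ 2 / (π ^ 2 * (((E : ℝ) + 4 * |(q : ℝ)|) * (((E : ℝ) - 1) * ((E : ℝ) + 2 * (4 * |(q : ℝ)|) - 1))))
        ≤ 2 * (4 * (hi : ℝ)) ^ 2 / (π ^ 2 * (((E : ℝ) + 4 * |(q : ℝ)|) * (((E : ℝ) - 1) * ((E : ℝ) + 2 * (4 * |(q : ℝ)|) - 1)))) :=
          div_le_div_of_nonneg_right (by linarith) hD1.le
      _ ≤ 2 * (4 * (hi : ℝ)) ^ 2 / (π ^ 2 * (((E : ℝ) + 4 * lo) * (((E : ℝ) - 1) * ((E : ℝ) + 8 * lo - 1)))) := by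
          apply div_le_div_of_nonneg_left (by positivity) hD0
          apply mul_le_mul_of_nonneg_left _ (by positivity)
          have hlo8 : 0 < (E : ℝ) + 8 * lo - 1 := by linarith
          exact mul_le_mul hd1 (mul_le_mul_of_nonneg_left hd2 h1) (mul_nonneg h1 hlo8.le) hpos1.le
  · -- inside part
    by_cases hin : (E : ℤ) ≤ |(4 * q : ℤ)|
    · rw [if_pos hin]
      have hin' : (E : ℤ) ≤ 4 * |q| := by rwa [abs_mul, show |(4:ℤ)| = 4 by norm_num] at hin
      have hhi4 : (E : ℤ) ≤ 4 * hi := by omega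
      rw [if_pos hhi4]
      have hl2 := hq2 hin'
      have hl2r : (lo2 : ℝ) ≤ |(q : ℝ)| := by
        have h : ((lo2 : ℤ) : ℝ) ≤ ((|q| : ℤ) : ℝ) := by exact_mod_cast hl2
        push_cast at h; exact h
      have hEr : (E : ℝ) ≤ 4 * |(q : ℝ)| := by
        have h : ((E : ℤ) : ℝ) ≤ ((4 * |q| : ℤ) : ℝ) := by exact_mod_cast hin'
        push_cast at h; exact h
      rw [hq4]
      refine add_le_add le_rfl ?_
      have hl2pos : (0 : ℝ) < lo2 := by exact_mod_cast hlo2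
      have hq0 : 0 < |(q : ℝ)| := by linarith
      rw [div_le_div_iff₀ (mul_pos (pow_pos hπ 2) (mul_pos (by linarith) (by positivity)))
        (mul_pos (pow_pos hπ 2) (mul_pos (by positivity) (by positivity)))]
      have h1 : 4 * |(q : ℝ)| - E + 1 ≤ 4 * (hi : ℝ) - E + 1 := by linarith
      have h2 : 4 * (lo2 : ℝ) * E ≤ 4 * |(q : ℝ)| * E := by nlinarith
      have h3 : 0 ≤ 4 * |(q : ℝ)| - E + 1 := by linarith
      calc 2 * (4 * |(q : ℝ)| - E + 1) * (π ^ 2 * (4 * (lo2 : ℝ) * E))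
          ≤ 2 * (4 * (hi : ℝ) - E + 1) * (π ^ 2 * (4 * |(q : ℝ)| * E)) :=
            mul_le_mul (by linarith) (mul_le_mul_of_nonneg_left h2 (by positivity)) (by positivity) (by linarith)
        _ = 2 * (4 * (hi : ℝ) - E + 1) * (π ^ 2 * (4 * |(q : ℝ)| * E)) := rfl
    · rw [if_neg hin]
      split_ifs
      · have : 0 < (E : ℝ) - 1 := by linarith
        have : 0 ≤ 4 * (hi : ℝ) - E + 1 := by
          have h : (E : ℤ) ≤ 4 * hi := by assumption
          have : ((E : ℤ) : ℝ) ≤ ((4 * hi : ℤ) : ℝ) := by exact_mod_cast h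
          push_cast at this; linarith
        positivity
      · exact le_rfl

/-! ## §2 Small arithmetic helpers -/

/-- `X/(π²·D) ≤ 0.101322·(X/D)` for `X ≥ 0`, `D > 0`. [folklore] -/
theorem div_pi_sq_le {X D : ℝ} (hX : 0 ≤ X) (hD : 0 < D) : X / (π ^ 2 * D) ≤ 0.101322 * (X / D) := by
  rw [mul_comm (π ^ 2) D, ← div_div, div_le_iff₀ (by positivity : (0 : ℝ) < π ^ 2)]
  have h := inv_pi_sq_le
  rw [div_le_iff₀ (by positivity)] at h
  have h0 : 0 ≤ X / D := div_nonneg hX hD.le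
  nlinarith

/-- The block mass bound with `1/π²` replaced by `0.101322`. [folklore] -/
theorem div_pi_sq_block_le (lo hi lo2 : ℕ) (hlo2 : 0 < lo2) :
    2 * (4 * (hi : ℝ)) ^ 2 / (π ^ 2 * (((175 : ℝ) + 4 * lo) * (((175 : ℝ) - 1) * ((175 : ℝ) + 8 * lo - 1)))) +
        (if (175 : ℤ) ≤ 4 * hi then 1 / (π ^ 2 * ((175 : ℝ) - 1)) + 2 * (4 * (hi : ℝ) - 175 + 1) / (π ^ 2 * (4 * (lo2 : ℝ) * 175)) else 0) ≤
      0.101322 * (2 * (4 * (hi : ℝ)) ^ 2 / (((175 : ℝ) + 4 * lo) * (((175 : ℝ) - 1) * ((175 : ℝ) + 8 * lo - 1))) +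
        (if (175 : ℤ) ≤ 4 * hi then 1 / ((175 : ℝ) - 1) + 2 * (4 * (hi : ℝ) - 175 + 1) / (4 * (lo2 : ℝ) * 175) else 0)) := by
  have hlo : (0 : ℝ) ≤ lo := Nat.cast_nonneg _
  have hD : 0 < ((175 : ℝ) + 4 * lo) * (((175 : ℝ) - 1) * ((175 : ℝ) + 8 * lo - 1)) := by
    have : (0 : ℝ) < 175 + 8 * lo - 1 := by linarith
    positivity
  have h1 := div_pi_sq_le (by positivity : (0 : ℝ) ≤ 2 * (4 * (hi : ℝ)) ^ 2) hD
  split_ifs with h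
  · have hhi : (0 : ℝ) ≤ 4 * (hi : ℝ) - 175 + 1 := by
      have : ((175 : ℤ) : ℝ) ≤ ((4 * hi : ℤ) : ℝ) := by exact_mod_cast h
      push_cast at this; linarith
    have hl2 : (0 : ℝ) < lo2 := by exact_mod_cast hlo2
    have h2 := div_pi_sq_le (by norm_num : (0 : ℝ) ≤ 1) (by norm_num : (0 : ℝ) < (175 : ℝ) - 1)
    have h3 := div_pi_sq_le (by positivity : (0 : ℝ) ≤ 2 * (4 * (hi : ℝ) - 175 + 1)) (by positivity : (0 : ℝ) < 4 * (lo2 : ℝ) * 175)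
    nlinarith [h1, h2, h3]
  · nlinarith [h1]

/-- Weighted block sums: if `0 ≤ w i ≤ Wb` on the block, `0 ≤ g`, `Σ g ≤ C` and `0 ≤ Wb`, then `Σ w·g ≤ Wb·C`. [folklore] -/
theorem sum_weight_mul_le {L : ℕ} {w g : ℕ → ℝ} {Wb C : ℝ} (hw : ∀ i ∈ Finset.range L, 0 ≤ w i ∧ w i ≤ Wb)
    (hg : ∀ i, 0 ≤ g i) (hC : ∑ i ∈ Finset.range L, g i ≤ C) (hWb : 0 ≤ Wb) :
    ∑ i ∈ Finset.range L, w i * g i ≤ Wb * C := by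
  calc ∑ i ∈ Finset.range L, w i * g i ≤ ∑ i ∈ Finset.range L, Wb * g i :=
        Finset.sum_le_sum fun i hi => mul_le_mul_of_nonneg_right (hw i hi).2 (hg i)
    _ = Wb * ∑ i ∈ Finset.range L, g i := by rw [Finset.mul_sum]
    _ ≤ Wb * C := mul_le_mul_of_nonneg_left hC hWb

/-- **Block step**: with `0 ≤ Mt ≤ Wb` on the fibres `lo ≤ |q| ≤ hi` of the block and the table bound `Σ L̄² ≤ C`,
`Σ_{i<hi−lo+1} Mt(lo+i)·L̄(lo+i)² ≤ Wb·C`. [folklore] -/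
theorem block_bound {Mt Lf : ℤ → ℝ} (hMt0 : ∀ q, 0 ≤ Mt q) {lo hi : ℕ} (hlohi : lo ≤ hi) {C Wb : ℝ}
    (hMtle : ∀ q : ℤ, (lo : ℤ) ≤ |q| → |q| ≤ hi → Mt q ≤ Wb) (hWb : 0 ≤ Wb)
    (hC : ∑ i ∈ Finset.range (hi - lo + 1), Lf ((lo : ℤ) + (i : ℕ)) ^ 2 ≤ C) :
    ∑ i ∈ Finset.range (hi - lo + 1), Mt ((lo : ℤ) + (i : ℕ)) * Lf ((lo : ℤ) + (i : ℕ)) ^ 2 ≤ Wb * C :=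
  sum_weight_mul_le (fun i hi' => ⟨hMt0 _, hMtle _ (by rw [le_abs]; left; omega)
    (by rw [Finset.mem_range] at hi'; rw [abs_le]; omega)⟩) (fun i => sq_nonneg _) hC hWb

section Cascade

variable (P : CascadeParams) (hγ : P.γ = 8) (hN₀ : P.N₀ = 1) (hρN : P.ρN = 2) (hd : P.d = 2) (hδ₀ : 0 < P.δ₀)
  (hδ₀' : P.δ₀ ≤ (2 : ℝ)⁻¹ ^ 30) (a b : ℕ → UnitAddTorus (Fin 2) → ℝ) (h0 : a 0 = datum)
  (hb : ∀ j, b j = a j ∘ shearMap 0 1 (amp ⟨P.U j, P.U_periodic j, P.contDiff_U (P.δ_pos hδ₀ (by rw [hd]; norm_num) j)⟩ P.γ))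
  (hab : ∀ j, a (j + 1) = b j ∘ shearMap 1 0 (amp ⟨P.U j, P.U_periodic j, P.contDiff_U (P.δ_pos hδ₀ (by rw [hd]; norm_num) j)⟩ P.γ))

include hγ hN₀ hρN hd hδ₀' h0 hb hab

/-! ## §3 One H-fibre off the tube, sharp constant -/

/-- **ONE H-FIBRE OF `b₁` OFF THE TUBE, SHARP**: as `phaseOne_offTube_fibre_le`, with the off-lobe mass constant `M(q,E)` of
`sum_offLobe_window_sq_norm_nTooth_sharp` in place of `6/(π²(E−1))`. [cite: Grafakos2014, Prop. 3.1.2 (5), Prop. 3.2.7 (3)] -/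
theorem phaseOne_offTube_fibre_sharp (q : ℤ) (Qc D₀ E : ℕ) (hE : 2 ≤ E) (hD : 2 * (E : ℤ) + Qc ≤ D₀) {L : ℝ}
    (hL : ∑ q' ∈ (Finset.Icc (-(Qc : ℤ)) Qc).filter (fun q' => 1 ≤ |q'|), ‖mFourierCoeff (fun x => (a 1 x : ℂ)) ![q, q']‖ ≤ L)
    (W : Finset ℤ) (hW : ∀ l ∈ W, (D₀ : ℤ) ≤ |(|l| - |8 * q|)|) :
    ∑ l ∈ W, ‖mFourierCoeff (fun x => (b 1 x : ℂ)) ![q, l]‖ ^ 2 ≤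
      (L * (Real.sqrt ((2 * ((4 * q : ℤ) : ℝ) ^ 2 / (π ^ 2 * (((E : ℝ) + |((4 * q : ℤ) : ℝ)|) * (((E : ℝ) - 1) * ((E : ℝ) + 2 * |((4 * q : ℤ) : ℝ)| - 1)))) + (if (E : ℤ) ≤ |(4 * q : ℤ)| then 1 / (π ^ 2 * ((E : ℝ) - 1)) + 2 * (|((4 * q : ℤ) : ℝ)| - E + 1) / (π ^ 2 * (|((4 * q : ℤ) : ℝ)| * E)) else 0))) + (2 : ℝ)⁻¹ ^ 27 * |(q : ℝ)|) +
        Real.sqrt (∑' q' : ℤ, (if q' ∈ (Finset.Icc (-(Qc : ℤ)) Qc).filter (fun q' => 1 ≤ |q'|) then 0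
          else ‖mFourierCoeff (fun x => (a 1 x : ℂ)) ![q, q']‖ ^ 2))) ^ 2 := by
  classical
  have hπ : 0 < π := Real.pi_pos
  have hd0 : 0 < P.d := by rw [hd]; norm_num
  have hE' : (2 : ℝ) ≤ E := by exact_mod_cast hE
  set ψ₀ : ShearProfile := amp ⟨P.U 0, P.U_periodic 0, P.contDiff_U (P.δ_pos hδ₀ hd0 0)⟩ P.γ with hψ₀
  set ψ₁ : ShearProfile := amp ⟨P.U 1, P.U_periodic 1, P.contDiff_U (P.δ_pos hδ₀ hd0 1)⟩ P.γ with hψ₁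
  have hb0 : b 0 = datum ∘ shearMap 0 1 ψ₀ := by rw [hb 0, h0]
  have ha1 : a 1 = b 0 ∘ shearMap 1 0 ψ₀ := hab 0
  have ha1s : IsSmooth (a 1) := by
    rw [ha1, hb0]; exact (isSmooth_datum_comp_shearMap ψ₀).comp_shearMap 1 0 ψ₀
  have ha1c : Continuous fun x => (a 1 x : ℂ) := Complex.continuous_ofReal.comp ha1s.continuous
  have ha1sum : Summable fun k => ‖mFourierCoeff (fun x => (a 1 x : ℂ)) k‖ :=
    summable_norm_mFourierCoeff_ofReal_of_isSmooth ha1s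
  have hb1 : (fun x => (b 1 x : ℂ)) = (fun x => (a 1 x : ℂ)) ∘ shearMap 0 1 ψ₁ := by
    rw [hb 1]; rfl
  set S : Finset ℤ := (Finset.Icc (-(Qc : ℤ)) Qc).filter (fun q' => 1 ≤ |q'|) with hS
  have hmink := sqrt_window_sq_norm_hstep_le ha1c ha1sum ψ₁ q S W
  rw [← hb1] at hmink
  set g₀ : UnitAddCircle → ℂ := (periodic_exactChirpFun 2 (8 * q)).lift with hg₀
  have hg₀c : Continuous g₀ := (continuous_exactChirp_lift 2 (8 * q)).1
  have hg₀t : ∀ t : ℝ, g₀ (t : UnitAddCircle) =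
      Complex.exp (-(2 * π * I * ((8 * q : ℤ)) * ((tri (2 * π * (2 : ℕ) * t) / (2 * π * (2 : ℕ)) : ℝ) : ℂ))) :=
    fun t => (continuous_exactChirp_lift 2 (8 * q)).2 t
  have hnear : ∀ t : ℝ, |q * ψ₁ t - ((8 * q : ℤ) : ℝ) * (tri (2 * π * (2 : ℕ) * t) / (2 * π * (2 : ℕ)))| ≤
      |(q : ℝ)| * ((2 * Real.exp (1 / 2) - 1) * P.δ₀ / π) := fun t => by
    rw [hψ₁]; exact phaseOne_profile_near P hγ hN₀ hρN hd hδ₀ q t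
  have hround : 2 * π * (|(q : ℝ)| * ((2 * Real.exp (1 / 2) - 1) * P.δ₀ / π)) ≤ (2 : ℝ)⁻¹ ^ 27 * |(q : ℝ)| :=
    phaseOne_rounding_le hδ₀.le hδ₀' q
  -- the sharp exact-chirp bound on off-lobe windows at distance `≥ 2E`
  set M : ℝ := (2 * ((4 * q : ℤ) : ℝ) ^ 2 / (π ^ 2 * (((E : ℝ) + |((4 * q : ℤ) : ℝ)|) * (((E : ℝ) - 1) * ((E : ℝ) + 2 * |((4 * q : ℤ) : ℝ)| - 1)))) + (if (E : ℤ) ≤ |(4 * q : ℤ)| then 1 / (π ^ 2 * ((E : ℝ) - 1)) + 2 * (|((4 * q : ℤ) : ℝ)| - E + 1) / (π ^ 2 * (|((4 * q : ℤ) : ℝ)| * E)) else 0)) with hMdef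
  have hL4 : (8 * q : ℤ) = (2 : ℕ) * (4 * q) := by push_cast; ring
  have hM : ∀ W' : Finset ℤ, (∀ m ∈ W', ((2 : ℕ) : ℤ) * E ≤ |(|m| - |((8 * q : ℤ))|)|) →
      ∑ m ∈ W', ‖fourierCoeff g₀ m‖ ^ 2 ≤ M := by
    intro W' hW'
    have h := sum_offLobe_window_sq_norm_nTooth_sharp (N := 2) two_pos (lam := 8 * q) (L := 4 * q) hL4 hg₀t hg₀c hE W' hW'
    rw [hMdef]
    exact h
  have hM0 : 0 ≤ M := by
    rw [hMdef]
    refine add_nonneg ?_ ?_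
    · have : 0 < (E : ℝ) - 1 := by linarith
      have : 0 < (E : ℝ) + 2 * |((4 * q : ℤ) : ℝ)| - 1 := by linarith [abs_nonneg (((4 * q : ℤ)) : ℝ)]
      positivity
    · split_ifs with h
      · have : 0 < (E : ℝ) - 1 := by linarith
        have hEr : (E : ℝ) ≤ |((4 * q : ℤ) : ℝ)| := by
          have : ((E : ℤ) : ℝ) ≤ ((|(4 * q : ℤ)| : ℤ) : ℝ) := by exact_mod_cast h
          push_cast at this ⊢; exact this
        have : 0 ≤ |((4 * q : ℤ) : ℝ)| - E + 1 := by linarith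
        have : 0 < |((4 * q : ℤ) : ℝ)| := by linarith
        positivity
      · exact le_rfl
  set ρ : ℝ := Real.sqrt M + (2 : ℝ)⁻¹ ^ 27 * |(q : ℝ)| with hρ
  have hρ0 : 0 ≤ ρ := by rw [hρ]; exact add_nonneg (Real.sqrt_nonneg _) (by positivity)
  have hmass : ∀ q' ∈ S, Real.sqrt (∑ l ∈ W, ‖fourierCoeff (twist ψ₁ q) (l - q')‖ ^ 2) ≤ ρ := by
    intro q' hq'
    have hq'Q : |q'| ≤ Qc := by
      rw [hS, Finset.mem_filter, Finset.mem_Icc] at hq'; exact abs_le.2 hq'.1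
    have hWd : ∀ l ∈ W, ((2 : ℕ) : ℤ) * E + Qc ≤ |(|l| - |((8 * q : ℤ))|)| := fun l hl => by
      have := hW l hl; push_cast at this ⊢; linarith
    have h := sum_offLobe_window_sq_norm_twist_of_exact ψ₁ q hg₀t hg₀c hnear (E := E) (Q := Qc) hM hq'Q W hWd
    have hη0 : 0 ≤ (2 * Real.exp (1 / 2) - 1) * P.δ₀ / π := by
      have := Real.add_one_le_exp (1 / 2 : ℝ)
      exact div_nonneg (mul_nonneg (by linarith) hδ₀.le) hπ.le
    have hs0 : 0 ≤ Real.sqrt M + 2 * π * (|(q : ℝ)| * ((2 * Real.exp (1 / 2) - 1) * P.δ₀ / π)) :=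
      add_nonneg (Real.sqrt_nonneg _) (mul_nonneg (by positivity) (mul_nonneg (abs_nonneg _) hη0))
    have h1 : Real.sqrt (∑ l ∈ W, ‖fourierCoeff (twist ψ₁ q) (l - q')‖ ^ 2) ≤
        Real.sqrt M + 2 * π * (|(q : ℝ)| * ((2 * Real.exp (1 / 2) - 1) * P.δ₀ / π)) := by
      rw [← Real.sqrt_le_sqrt_iff (by positivity)] at h
      rwa [Real.sqrt_sq hs0] at h
    rw [hρ]; linarith
  have hsum : ∑ q' ∈ S, ‖mFourierCoeff (fun x => (a 1 x : ℂ)) ![q, q']‖ *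
      Real.sqrt (∑ l ∈ W, ‖fourierCoeff (twist ψ₁ q) (l - q')‖ ^ 2) ≤ L * ρ := by
    calc ∑ q' ∈ S, ‖mFourierCoeff (fun x => (a 1 x : ℂ)) ![q, q']‖ *
          Real.sqrt (∑ l ∈ W, ‖fourierCoeff (twist ψ₁ q) (l - q')‖ ^ 2)
        ≤ ∑ q' ∈ S, ‖mFourierCoeff (fun x => (a 1 x : ℂ)) ![q, q']‖ * ρ :=
          Finset.sum_le_sum fun q' hq' => mul_le_mul_of_nonneg_left (hmass q' hq') (norm_nonneg _)
      _ = (∑ q' ∈ S, ‖mFourierCoeff (fun x => (a 1 x : ℂ)) ![q, q']‖) * ρ := by rw [Finset.sum_mul]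
      _ ≤ L * ρ := mul_le_mul_of_nonneg_right hL hρ0
  have hX0 : 0 ≤ ∑ l ∈ W, ‖mFourierCoeff (fun x => (b 1 x : ℂ)) ![q, l]‖ ^ 2 := Finset.sum_nonneg fun _ _ => sq_nonneg _
  have hfin := hmink.trans (add_le_add hsum le_rfl)
  calc ∑ l ∈ W, ‖mFourierCoeff (fun x => (b 1 x : ℂ)) ![q, l]‖ ^ 2
      = Real.sqrt (∑ l ∈ W, ‖mFourierCoeff (fun x => (b 1 x : ℂ)) ![q, l]‖ ^ 2) ^ 2 := (Real.sq_sqrt hX0).symm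
    _ ≤ _ := pow_le_pow_left₀ (Real.sqrt_nonneg _) hfin 2

end Cascade

end Summit.AnomalousDissipation.AnomalousDissipation.Theorems.SawtoothPulseCascade.K1Start
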